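import Literature.IUT.HodgeArakelov.CoreTowerNonVacuity
import Literature.IUT.HodgeArakelov.CommutatorPairingIdentities
import Literature.IUT.HodgeArakelov.ThetaQuotientDataNonVacuity
import Literature.IUT.HodgeArakelov.ModelReconstructionLZ
import Literature.AnabelianGeometry.EtaleTheta.Discharge.Sec2DtpYThetaAbelianCorollaries
import HarnessLib

/-!
# [IUTchII] Rmk. 1.1.1 (iii): NON-VACUITY of `TwoSections` — theta section, algebraic section and the bilinear
# commutator map `[-,-] : (Δ_X(M)/Δ_Y(M)) × Δ^ell_Y(M) → Π_M|_{(l·Δ_Θ)(M)}` EXIST at the [EtTh] model (GENUINE witness)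

Mochizuki, *Inter-universal Teichmüller theory II*, §1, Remark 1.1.1 (iii), kurims manuscript (Dec. 2020) pp. 22–23
[claim: Mochizuki2012, status: disputed] (IUTchII §1 Rmk 1.1.1 (iii), kurims pp.22-23): "the theta section portion
determines, by restriction, a subgroup `s^Θ(M)|_{(l·Δ_Θ)} ⊆ Π_M|_{(l·Δ_Θ)}` that maps isomorphically to `(l·Δ_Θ)(M)` …
forming the commutator `γ(β)·β⁻¹` … one obtains a natural bilinear commutator map `[-,-] : (Δ_X(M)/Δ_Y(M)) × Δ^ell_Y(M)
→ Π_M|_{(l·Δ_Θ)(M)}` … whose image determines a subgroup `s^alg(M)|_{(l·Δ_Θ)}` that maps isomorphically to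
`(l·Δ_Θ)(M)`." Record-only vocabulary under the claim key `Mochizuki2012` (D-0012, disputed); abc-iut cell, layer L6,
NV-L6 register row **TwoSections** ((P1) = `CoreTowerNonVacuity` p432880, (P2) = abc-iut-w4-d030's
`ModelReconstructionLZ` p421084, (P3) = THIS FILE), seat abc-iut-w5-d225 (gen 5): a NON-VACUITY CERTIFICATE for
abc-iut-L6-t1's interface `TwoSections T W` (`MonoThetaSymmetries.lean`).

WITNESS (GENUINE): at B8's `F.reconstruction e` of a mono-theta environment identified (`e`) with the [EtTh] model
`Π^tp_{Y̲̲}[μ_N]` of abc-iut-L2-t8's `R := C.rigidData μ hC hS h15 L`, over the C-level data of a `MuTwoSetting`, under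
`IsEtThOrigin` + `hYcl`, for the `T` of abc-iut-w4-d030's `ModelFrame.exists_thetaQuotientData_model` and EVERY core
tower `W` with `Ker(Π_Y(M) ↠ Π^ell_Y(M)) = Ker(Π^tp_X ↠ (Π^tp_X)^ell) ∩ Π^tp_{Y̲̲}` (e.g. the `W` of
`ModelFrame.exists_coreTower_of_cLevelData`) — `exists_twoSections_of_coreTower`; the (P1)-tower and level-`M` corollaries
are the sequel `TwoSectionsNonVacuityLevels.lean`: `s^Θ|_{(l·Δ_Θ)} :=` classes of `e⁻¹ ∘ s^Θ_η` on the `(l·Δ_Θ)`-preimage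
`R.lDeltaTheta` (`η` a theta cocycle of the collection; L2 `ThetaEnvData.sTheta`); the commutator map `(a, y) ↦
[e⁻¹(s^alg(x_a b_y x_a⁻¹ b_y⁻¹))]` for a `Δ_{X̲̲}`-lift `x_a` of `a ∈ (l·ℤ)(M)` (`ModelCyclotomes.augY_surjective`) and a
`Δ_{Y̲̲}`-lift `b_y` of `y ∈ Δ^ell_Y(M)` — well defined and BILINEAR because `Δ_Θ` is commutative and central in
`(Δ^tp_X)^Θ` (root fields `ker_thetaToEll_comm/central`), `(Δ^tp_Y)^Θ` is abelian (abc-iut-L2-t8's THEOREM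
`ThetaSetting.dtpYTheta_comm`) and changing a lift changes the commutator by an element of `Ker θ` (identities
`conjComm_*`, `CommutatorPairingIdentities.lean`); `s^alg|_{(l·Δ_Θ)} :=` the subgroup generated by its values
(`sAlg_eq_closure` by `rfl`); both sections map BIJECTIVELY onto `(l·Δ_Θ)(M) = (preimage of l·Δ_Θ)/thetaKer` —
surjectivity of `s^alg` is **Heisenberg surjectivity**, [EtTh] Prop. 2.12 (i) for the §1 model in abc-iut-L5-t14 /
L2-t8's form `DoubleUnderline.rigidData_hcomm_of_origin` (`t = z b z⁻¹ b⁻¹ k`, `z ∈ Δ_{X̲̲}`, `b ∈ Δ_{Y̲̲}`, `k ∈ Ker θ`);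
`Π_μ ∩ s^Θ|_{Ker} = 1` is `T`'s third clause; `(l·ℤ)(M) ≅ ℤ` is (P2). PROOF-ONLY (no `def`/`instance`/`structure`).
HONEST FRAMING: a kernel fact about the cell's own typed interfaces ([EtTh] refereed; the C-level record, `IsEtThOrigin`, `hYcl` are explicit hypotheses); NOT asserted:
`rigidity_is_difference`, `FlSymmetry`, anything of [IUTchII]; no side taken on [IUTchIII] Cor. 3.12 (node outside the
cone); typed ≠ discharged; witnessed ≠ endorsed. [cite: MochizukiEtTh2009, Prop 2.12 (i) p.45]
-/

noncomputable section

namespace Literature.IUT.HodgeArakelov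

open Literature.AnabelianGeometry.EtaleTheta Literature.AnabelianGeometry.SemiGraphs
open scoped Literature.AnabelianGeometry.EtaleTheta

namespace ModelFrame

variable {p : ℕ} [Fact p.Prime] {Mt : MuTwoSetting p}
  {E : Mt.toThetaSetting.EtaleThetaData} {l : ℕ} (C : E.DoubleUnderline l)
  {S : ThetaSetting.{0}} (μ : Mt.toThetaSetting.CyclotomeMod l S.N)
  (hC : Mt.toThetaSetting.Compat) (hS : Mt.toThetaSetting.Sec2Hyps)
  (h15 : ThetaSetting.Prop15iii E hC) (L : C.CuspLabels)
  (F : ModelFrame S (C.rigidData μ hC hS h15 L)) {Menv : MonoThetaEnv S}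
  (e : Menv.Pi ≃ₜ* (C.rigidData μ hC hS h15 L).env)

/-- **IUTchII:Rmk1.1.1(iii) — NON-VACUITY of `TwoSections` at the [EtTh] model, GENUINE witness, for EVERY core tower
`W` whose `Ker(Π_Y(M) ↠ Π^ell_Y(M))` is `Ker(Π^tp_X ↠ (Π^tp_X)^ell) ∩ Π^tp_{Y̲̲}`** (the only datum of `W` the sections
see; e.g. the tower of (P1) `exists_coreTower_of_cLevelData`): for the Def. 1.1 (i) output `F.reconstruction e` of a
mono-theta environment identified with the model of the rigidity data of `X̲̲ → X` over a `MuTwoSetting`, under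
`IsEtThOrigin` and `hYcl`, there are the theta-quotient data `T` of abc-iut-w4-d030 (`T.thetaSection =
e⁻¹(s^alg(thetaKer))` pinned) and a `TwoSections T W`: `s^Θ|_{(l·Δ_Θ)}` = classes of `e⁻¹ ∘ s^Θ_η` on the `(l·Δ_Θ)`-preimage, the commutator map
`(a, y) ↦ [e⁻¹(s^alg[x_a, b_y])]` on `Δ_{X̲̲}`- and `Δ_{Y̲̲}`-lifts (bilinear by centrality of `Δ_Θ` and abelianness of
`(Δ^tp_Y)^Θ`), `s^alg|_{(l·Δ_Θ)}` = the subgroup its values generate, both sections bijective onto `(l·Δ_Θ)(M)` by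
Heisenberg surjectivity ([EtTh] Prop. 2.12 (i), `rigidData_hcomm_of_origin`), `Π_μ ∩ s^Θ|_{Ker} = 1`, `(l·ℤ)(M) ≅ ℤ`
(P2). [claim: Mochizuki2012, status: disputed] (IUTchII §1 Rmk 1.1.1 (iii), kurims pp.22-23) -/
theorem exists_twoSections_of_coreTower (hO : Mt.toThetaSetting.IsEtThOrigin)
    (hYcl : (Mt.DtpY.map Mt.toHat.toMonoidHom).topologicalClosure ≤
      Mt.DtpY.map Mt.toHat.toMonoidHom ⊔ (⁅⁅Mt.DeltaHat, Mt.DeltaHat⁆, Mt.DeltaHat⁆).topologicalClosure)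
    (W : CoreTower (F.reconstruction e))
    (hWker : W.kerEll = ((Mt.thetaToEll.comp Mt.toTheta).ker).comap
      (C.Huu.subtype.comp (Mt.GtpY.subgroupOf C.Huu).subtype)) :
    ∃ T : ThetaQuotientData (F.reconstruction e),
      T.thetaSection = (((C.rigidData μ hC hS h15 L).thetaKer.subgroupOf (C.rigidData μ hC hS h15 L).PiY).map
          (CycEnvelope.algSection (C.rigidData μ hC hS h15 L).augY (C.rigidData μ hC hS h15 L).chi)).comap
          e.toMulEquiv.toMonoidHom ∧ Nonempty (TwoSections T W) := by
  classical
  set R : RigidData S.N l := C.rigidData μ hC hS h15 L with hRdef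
  obtain ⟨T, hTker, hTsec, hText⟩ := ModelFrame.exists_thetaQuotientData_model F e
  refine ⟨T, hTsec, ?_⟩
  haveI hinclYn : (F.reconstruction e).inclY.range.Normal := (F.reconstruction e).inclY_normal
  haveI hkerElln : W.kerEll.Normal := W.kerEll_normal
  haveI hdeltaElln : (W.kerEll.subgroupOf (F.reconstruction e).DeltaY).Normal := W.deltaEll_normal
  have haugR : ∀ x : ↥C.Huu, x ∈ R.aug.ker ↔ Mt.aug (x : Mt.PiTemp) = 1 := fun x => by
    rw [MonoidHom.mem_ker, ← OneMemClass.coe_eq_one]; rfl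
  have hlDT_PiY : R.lDeltaTheta ≤ R.PiY := fun t ht => R.PiYdd_le (R.lDeltaTheta_le ht).1
  have hlDT_PiYdd : R.lDeltaTheta ≤ R.PiYdd := fun t ht => (R.lDeltaTheta_le ht).1
  have hmemL : ∀ t : ↥C.Huu, t ∈ R.lDeltaTheta ↔ Mt.toTheta (t : Mt.PiTemp) ∈ Mt.lDeltaTheta l :=
    fun _ => Iff.rfl
  have hmemK : ∀ t : ↥C.Huu, t ∈ R.thetaKer ↔ Mt.toTheta (t : Mt.PiTemp) = 1 := fun _ => Iff.rfl
  have hcomm := C.rigidData_hcomm_of_origin μ hC hS h15 L hO hYcl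
  have hΔY : ∀ y : ↥(F.reconstruction e).DeltaY,
      Mt.aug (((y : ↥(Mt.GtpY.subgroupOf C.Huu)) : ↥C.Huu) : Mt.PiTemp) = 1 := fun y =>
    (mem_deltaY_reconstruction_iff C μ hC hS h15 L F e y.1).1 y.2
  have hcent : ∀ c ∈ Mt.DeltaTheta, ∀ g ∈ (Mt.aug.toMonoidHom.ker).map Mt.toTheta, c * g = g * c :=
    fun c hc g hg => Mt.ker_thetaToEll_central c hc g hg
  have hcommΘ : ∀ c₁ ∈ Mt.DeltaTheta, ∀ c₂ ∈ Mt.DeltaTheta, c₁ * c₂ = c₂ * c₁ :=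
    fun c₁ h₁ c₂ h₂ => Mt.ker_thetaToEll_comm c₁ h₁ c₂ h₂
  have hYab : ∀ h₁ ∈ Mt.DtpYTheta, ∀ h₂ ∈ Mt.DtpYTheta, h₁ * h₂ = h₂ * h₁ :=
    Mt.toThetaSetting.dtpYTheta_comm hO
  have hθΔ : ∀ x : ↥C.Huu, Mt.aug (x : Mt.PiTemp) = 1 →
      Mt.toTheta (x : Mt.PiTemp) ∈ (Mt.aug.toMonoidHom.ker).map Mt.toTheta := fun x hx =>
    Subgroup.mem_map_of_mem _ (by exact hx)
  have hθY : ∀ b : ↥(Mt.GtpY.subgroupOf C.Huu), Mt.aug ((b : ↥C.Huu) : Mt.PiTemp) = 1 →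
      Mt.toTheta ((b : ↥C.Huu) : Mt.PiTemp) ∈ Mt.DtpYTheta := fun b hb =>
    Subgroup.mem_map_of_mem _ ⟨Subgroup.mem_subgroupOf.1 b.2, hb⟩
  have hYΔ : Mt.DtpYTheta ≤ (Mt.aug.toMonoidHom.ker).map Mt.toTheta := Subgroup.map_mono inf_le_right
  have htop : ∀ m : Menv.Pi, m ∈ T.envAtTheta.top ↔
      (((F.reconstruction e).projY m : ↥R.PiY) : ↥C.Huu) ∈ R.lDeltaTheta := fun m => Iff.rfl
  have hbot : ∀ m : Menv.Pi, m ∈ T.envAtTheta.bot ↔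
      e m ∈ ((R.thetaKer.subgroupOf R.PiY).map (CycEnvelope.algSection R.augY R.chi)) := fun m => by
    change m ∈ T.thetaSection ↔ _
    rw [hTsec]
    rfl
  have hprojY : ∀ m : Menv.Pi, (F.reconstruction e).projY m = (e m).right := fun m => rfl
  -- ### the algebraic section as a homomorphism `(l·Δ_Θ)-preimage → Π_M|_{(l·Δ_Θ)}`
  let ι₁ : ↥R.lDeltaTheta →* ↥R.PiY := Subgroup.inclusion hlDT_PiY
  let f₀ : ↥R.lDeltaTheta →* Menv.Pi :=
    e.symm.toMulEquiv.toMonoidHom.comp ((CycEnvelope.algSection R.augY R.chi).comp ι₁)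
  have hf₀e : ∀ t, e (f₀ t) = CycEnvelope.algSection R.augY R.chi (ι₁ t) := fun t =>
    e.apply_symm_apply _
  have hf₀proj : ∀ t, (F.reconstruction e).projY (f₀ t) = ι₁ t := fun t => by
    rw [hprojY, hf₀e]; rfl
  have hf₀top : ∀ t, f₀ t ∈ T.envAtTheta.top := fun t => by
    rw [htop, hf₀proj]; exact t.2
  let f₁ : ↥R.lDeltaTheta →* ↥T.envAtTheta.top := f₀.codRestrict _ hf₀top
  let Sg : ↥R.lDeltaTheta →* T.envAtTheta.carrier :=
    (QuotientGroup.mk' (T.envAtTheta.bot.subgroupOf T.envAtTheta.top)).comp f₁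
  have hSg_one : ∀ t : ↥R.lDeltaTheta, Mt.toTheta ((t : ↥C.Huu) : Mt.PiTemp) = 1 → Sg t = 1 := by
    intro t ht
    change (QuotientGroup.mk (f₁ t) : T.envAtTheta.carrier) = 1
    rw [QuotientGroup.eq_one_iff, Subgroup.mem_subgroupOf]
    change f₀ t ∈ T.envAtTheta.bot
    rw [hbot, hf₀e]
    exact Subgroup.mem_map_of_mem _ (Subgroup.mem_subgroupOf.2 ((hmemK _).2 ht))
  have hSg_eq : ∀ t t' : ↥R.lDeltaTheta,
      Mt.toTheta ((t : ↥C.Huu) : Mt.PiTemp) = Mt.toTheta ((t' : ↥C.Huu) : Mt.PiTemp) → Sg t = Sg t' := by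
    intro t t' h
    have h1 : Sg (t⁻¹ * t') = 1 := hSg_one _ (by
      change Mt.toTheta (((t : ↥C.Huu) : Mt.PiTemp)⁻¹ * ((t' : ↥C.Huu) : Mt.PiTemp)) = 1
      rw [map_mul, map_inv, h, inv_mul_cancel])
    calc Sg t = Sg t * Sg (t⁻¹ * t') := by rw [h1, mul_one]
      _ = Sg t' := by rw [← map_mul, mul_inv_cancel_left]
  have hSg_mul : ∀ t t₁ t₂ : ↥R.lDeltaTheta, Mt.toTheta ((t : ↥C.Huu) : Mt.PiTemp) =
      Mt.toTheta ((t₁ : ↥C.Huu) : Mt.PiTemp) * Mt.toTheta ((t₂ : ↥C.Huu) : Mt.PiTemp) →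
        Sg t = Sg t₁ * Sg t₂ := fun t t₁ t₂ h => by
    rw [← map_mul]; exact hSg_eq _ _ (by rw [h, ← map_mul]; rfl)
  have hSg_proj : ∀ t : ↥R.lDeltaTheta, T.proj (Sg t) =
      (QuotientGroup.mk (⟨ι₁ t, t.2⟩ : ↥(F.reconstruction e).intCyc.top) :
        (F.reconstruction e).intCyc.carrier) := by
    intro t
    change T.proj (QuotientGroup.mk (f₁ t)) = _
    rw [ThetaQuotientData.proj, QuotientGroup.map_mk]
    congr 1
    apply Subtype.ext
    exact hf₀proj t
  -- ### the theta section as a homomorphism `(l·Δ_Θ)-preimage → Π_M|_{(l·Δ_Θ)}`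
  obtain ⟨η, hη⟩ := R.thetaCocycles_nonempty
  let ι₂ : ↥R.lDeltaTheta →* ↥R.PiYdd := Subgroup.inclusion hlDT_PiYdd
  let g₀ : ↥R.lDeltaTheta →* Menv.Pi :=
    e.symm.toMulEquiv.toMonoidHom.comp ((R.toThetaEnvData.sTheta hη).comp ι₂)
  have hg₀e : ∀ t, e (g₀ t) = R.toThetaEnvData.sTheta hη (ι₂ t) := fun t => e.apply_symm_apply _
  have hg₀proj : ∀ t, (F.reconstruction e).projY (g₀ t) = ι₁ t := fun t => by
    rw [hprojY, hg₀e]; rfl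
  have hg₀top : ∀ t, g₀ t ∈ T.envAtTheta.top := fun t => by
    rw [htop, hg₀proj]; exact t.2
  let g₁ : ↥R.lDeltaTheta →* ↥T.envAtTheta.top := g₀.codRestrict _ hg₀top
  let SgΘ : ↥R.lDeltaTheta →* T.envAtTheta.carrier :=
    (QuotientGroup.mk' (T.envAtTheta.bot.subgroupOf T.envAtTheta.top)).comp g₁
  have hSgΘ_one : ∀ t : ↥R.lDeltaTheta, Mt.toTheta ((t : ↥C.Huu) : Mt.PiTemp) = 1 → SgΘ t = 1 := by
    intro t ht
    change (QuotientGroup.mk (g₁ t) : T.envAtTheta.carrier) = 1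
    rw [QuotientGroup.eq_one_iff, Subgroup.mem_subgroupOf]
    change g₀ t ∈ T.envAtTheta.bot
    rw [hbot, hg₀e, ModelFrame.sTheta_eq_algSection_of_mem_thetaKer hη (ι₂ t) ((hmemK _).2 ht)]
    exact Subgroup.mem_map_of_mem _ (Subgroup.mem_subgroupOf.2 ((hmemK _).2 ht))
  have hSgΘ_eq : ∀ t t' : ↥R.lDeltaTheta,
      Mt.toTheta ((t : ↥C.Huu) : Mt.PiTemp) = Mt.toTheta ((t' : ↥C.Huu) : Mt.PiTemp) →
        SgΘ t = SgΘ t' := by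
    intro t t' h
    have h1 : SgΘ (t⁻¹ * t') = 1 := hSgΘ_one _ (by
      change Mt.toTheta (((t : ↥C.Huu) : Mt.PiTemp)⁻¹ * ((t' : ↥C.Huu) : Mt.PiTemp)) = 1
      rw [map_mul, map_inv, h, inv_mul_cancel])
    calc SgΘ t = SgΘ t * SgΘ (t⁻¹ * t') := by rw [h1, mul_one]
      _ = SgΘ t' := by rw [← map_mul, mul_inv_cancel_left]
  have hSgΘ_proj : ∀ t : ↥R.lDeltaTheta, T.proj (SgΘ t) =
      (QuotientGroup.mk (⟨ι₁ t, t.2⟩ : ↥(F.reconstruction e).intCyc.top) :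
        (F.reconstruction e).intCyc.carrier) := by
    intro t
    change T.proj (QuotientGroup.mk (g₁ t)) = _
    rw [ThetaQuotientData.proj, QuotientGroup.map_mk]
    congr 1
    apply Subtype.ext
    exact hg₀proj t
  have hmk_eq : ∀ t t' : ↥R.lDeltaTheta,
      (QuotientGroup.mk (⟨ι₁ t, t.2⟩ : ↥(F.reconstruction e).intCyc.top) :
        (F.reconstruction e).intCyc.carrier) =
      QuotientGroup.mk (⟨ι₁ t', t'.2⟩ : ↥(F.reconstruction e).intCyc.top) →
      Mt.toTheta ((t : ↥C.Huu) : Mt.PiTemp) = Mt.toTheta ((t' : ↥C.Huu) : Mt.PiTemp) := by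
    intro t t' h
    rw [QuotientGroup.eq, Subgroup.mem_subgroupOf] at h
    have h' : ((t : ↥C.Huu)⁻¹ * (t' : ↥C.Huu)) ∈ R.thetaKer := h
    rw [hmemK] at h'
    change Mt.toTheta (((t : ↥C.Huu) : Mt.PiTemp)⁻¹ * ((t' : ↥C.Huu) : Mt.PiTemp)) = 1 at h'
    rw [map_mul, map_inv, inv_mul_eq_one] at h'
    exact h'
  have hxrep : ∀ a : (F.reconstruction e).lZ, ∃ x : ↥C.Huu,
      (QuotientGroup.mk x : ↥C.Huu ⧸ (F.reconstruction e).inclY.range) = a ∧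
        Mt.aug (x : Mt.PiTemp) = 1 := by
    intro a
    obtain ⟨x₀, rfl⟩ := QuotientGroup.mk_surjective a
    obtain ⟨y, hy⟩ := ModelCyclotomes.augY_surjective R (R.aug x₀)
    refine ⟨x₀ * (y : ↥C.Huu)⁻¹, ?_, ?_⟩
    · refine (QuotientGroup.eq.2 ?_).symm
      rw [← mul_assoc, inv_mul_cancel, one_mul]
      exact inv_mem ⟨y, rfl⟩
    · rw [← haugR, MonoidHom.mem_ker, map_mul, map_inv, mul_inv_eq_one]
      exact hy.symm
  choose xrep hxrep_mk hxrep_aug using hxrep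
  have hyrep : ∀ y : W.DeltaYell, ∃ b : ↥(F.reconstruction e).DeltaY,
      (QuotientGroup.mk b : W.DeltaYell) = y := fun y => QuotientGroup.mk_surjective y
  choose yrep hyrep_mk using hyrep
  -- ### the commutator of a lift and `Δ_Y(M)` lies in the `(l·Δ_Θ)`-preimage
  have hcm_mem : ∀ (x : ↥C.Huu), Mt.aug (x : Mt.PiTemp) = 1 →
      ∀ b : ↥(Mt.GtpY.subgroupOf C.Huu), Mt.aug ((b : ↥C.Huu) : Mt.PiTemp) = 1 →
        x * (b : ↥C.Huu) * x⁻¹ * (b : ↥C.Huu)⁻¹ ∈ R.lDeltaTheta := by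
    intro x hx b hb
    refine (hcomm _).2 ⟨x, (haugR x).2 hx, (b : ↥C.Huu), ⟨b.2, (haugR _).2 hb⟩, 1, one_mem _, ?_⟩
    rw [mul_one]
  let cmR : (F.reconstruction e).lZ → W.DeltaYell → ↥R.lDeltaTheta := fun a y =>
    ⟨xrep a * ((yrep y : ↥(Mt.GtpY.subgroupOf C.Huu)) : ↥C.Huu) * (xrep a)⁻¹ *
        (((yrep y : ↥(Mt.GtpY.subgroupOf C.Huu)) : ↥C.Huu))⁻¹,
      hcm_mem (xrep a) (hxrep_aug a) _ (hΔY (yrep y))⟩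
  have θcm : ∀ x b : ↥C.Huu, Mt.toTheta (((x * b * x⁻¹ * b⁻¹ : ↥C.Huu)) : Mt.PiTemp) =
      Mt.toTheta (x : Mt.PiTemp) * Mt.toTheta (b : Mt.PiTemp) * (Mt.toTheta (x : Mt.PiTemp))⁻¹ *
        (Mt.toTheta (b : Mt.PiTemp))⁻¹ := fun x b => by
    simp only [Subgroup.coe_mul, Subgroup.coe_inv, map_mul, map_inv]
  have hcmΔΘ : ∀ (x : ↥C.Huu), Mt.aug (x : Mt.PiTemp) = 1 →
      ∀ b : ↥(Mt.GtpY.subgroupOf C.Huu), Mt.aug ((b : ↥C.Huu) : Mt.PiTemp) = 1 →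
        Mt.toTheta (x : Mt.PiTemp) * Mt.toTheta ((b : ↥C.Huu) : Mt.PiTemp) *
          (Mt.toTheta (x : Mt.PiTemp))⁻¹ * (Mt.toTheta ((b : ↥C.Huu) : Mt.PiTemp))⁻¹ ∈ Mt.DeltaTheta := by
    intro x hx b hb
    rw [← θcm]
    exact Mt.toThetaSetting.lDeltaTheta_le l ((hmemL _).1 (hcm_mem x hx b hb))
  -- (T1) changing the `Δ_{X̲̲}`-representative of an `(l·ℤ)(M)`-class
  have hrepX : ∀ (x x' : ↥C.Huu), Mt.aug (x : Mt.PiTemp) = 1 → Mt.aug (x' : Mt.PiTemp) = 1 →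
      (QuotientGroup.mk x : ↥C.Huu ⧸ (F.reconstruction e).inclY.range) = QuotientGroup.mk x' →
      ∀ b : ↥(Mt.GtpY.subgroupOf C.Huu), Mt.aug ((b : ↥C.Huu) : Mt.PiTemp) = 1 →
        Mt.toTheta (((x * b * x⁻¹ * (b : ↥C.Huu)⁻¹ : ↥C.Huu)) : Mt.PiTemp) =
          Mt.toTheta (((x' * b * x'⁻¹ * (b : ↥C.Huu)⁻¹ : ↥C.Huu)) : Mt.PiTemp) := by
    intro x x' hx hx' hxx' b hb
    rw [QuotientGroup.eq] at hxx'
    obtain ⟨δ, hδ⟩ := hxx'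
    have hδY : ((δ : ↥C.Huu) : Mt.PiTemp) ∈ Mt.GtpY := Subgroup.mem_subgroupOf.1 δ.2
    have hx'eq : x' = x * (δ : ↥C.Huu) := by
      have : (δ : ↥C.Huu) = x⁻¹ * x' := hδ
      rw [this, mul_inv_cancel_left]
    have hδaug : Mt.aug ((δ : ↥C.Huu) : Mt.PiTemp) = 1 := by
      have : (δ : ↥C.Huu) = x⁻¹ * x' := hδ
      rw [this, Subgroup.coe_mul, Subgroup.coe_inv, map_mul, map_inv, hx, hx', inv_one, one_mul]
    have hδΘ : Mt.toTheta ((δ : ↥C.Huu) : Mt.PiTemp) ∈ Mt.DtpYTheta :=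
      Subgroup.mem_map_of_mem _ ⟨hδY, hδaug⟩
    rw [hx'eq, θcm, θcm, Subgroup.coe_mul, map_mul]
    exact (conjComm_central_mul_left _ _ _ (hYab _ hδΘ _ (hθY b hb))).symm
  -- (T2) changing the `Δ_Y(M)`-representative of a `Δ^ell_Y(M)`-class
  have hrepY : ∀ (x : ↥C.Huu), Mt.aug (x : Mt.PiTemp) = 1 →
      ∀ b b' : ↥(F.reconstruction e).DeltaY, (QuotientGroup.mk b : W.DeltaYell) = QuotientGroup.mk b' →
        Mt.toTheta (((x * ((b : ↥(Mt.GtpY.subgroupOf C.Huu)) : ↥C.Huu) * x⁻¹ *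
            (((b : ↥(Mt.GtpY.subgroupOf C.Huu)) : ↥C.Huu))⁻¹ : ↥C.Huu)) : Mt.PiTemp) =
          Mt.toTheta (((x * ((b' : ↥(Mt.GtpY.subgroupOf C.Huu)) : ↥C.Huu) * x⁻¹ *
            (((b' : ↥(Mt.GtpY.subgroupOf C.Huu)) : ↥C.Huu))⁻¹ : ↥C.Huu)) : Mt.PiTemp) := by
    intro x hx b b' hbb'
    rw [QuotientGroup.eq, Subgroup.mem_subgroupOf, hWker, Subgroup.mem_comap, MonoidHom.mem_ker] at hbb'
    have hc : Mt.toTheta ((((b : ↥(Mt.GtpY.subgroupOf C.Huu)) : ↥C.Huu) : Mt.PiTemp)⁻¹ *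
        (((b' : ↥(Mt.GtpY.subgroupOf C.Huu)) : ↥C.Huu) : Mt.PiTemp)) ∈ Mt.DeltaTheta := by
      change Mt.thetaToEll _ = 1
      exact hbb'
    set β := Mt.toTheta ((((b : ↥(Mt.GtpY.subgroupOf C.Huu)) : ↥C.Huu) : Mt.PiTemp)) with hβ
    set β' := Mt.toTheta ((((b' : ↥(Mt.GtpY.subgroupOf C.Huu)) : ↥C.Huu) : Mt.PiTemp)) with hβ'
    have hβ'eq : β' = β * (β⁻¹ * β') := by rw [mul_inv_cancel_left]
    rw [θcm, θcm, ← hβ, ← hβ', hβ'eq]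
    refine (conjComm_mul_central_right _ _ _ ?_).symm
    rw [map_mul, map_inv] at hc
    exact hcent _ hc _ (inv_mem (hθΔ x hx))
  refine ⟨{ sTheta := SgΘ.range
            sAlg := Subgroup.closure
              (Set.range fun q : (F.reconstruction e).lZ × W.DeltaYell => Sg (cmR q.1 q.2))
            sTheta_bijOn := ?_
            sAlg_bijOn := ?_
            extCyc_inf_bot := hText
            commutator := fun a y => Sg (cmR a y)
            commutator_mul_left := ?_
            commutator_mul_right := ?_
            lZ_iso := ModelFrame.nonempty_lZ_mulEquiv_int F e
            sAlg_eq_closure := rfl }⟩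
  · -- `s^Θ|_{(l·Δ_Θ)}` maps bijectively onto `(l·Δ_Θ)(M)`
    refine ⟨fun _ _ => Set.mem_univ _, ?_, ?_⟩
    · rintro _ ⟨t₁, rfl⟩ _ ⟨t₂, rfl⟩ h
      rw [hSgΘ_proj, hSgΘ_proj] at h
      exact hSgΘ_eq _ _ (hmk_eq _ _ h)
    · intro c _
      obtain ⟨g, rfl⟩ := QuotientGroup.mk_surjective c
      refine ⟨SgΘ ⟨((g : ↥R.PiY) : ↥C.Huu), g.2⟩, ⟨_, rfl⟩, ?_⟩
      rw [hSgΘ_proj]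
      rfl
  · -- `s^alg|_{(l·Δ_Θ)}` maps bijectively onto `(l·Δ_Θ)(M)` (Heisenberg surjectivity, [EtTh] Prop. 2.12 (i))
    have hle : Subgroup.closure
        (Set.range fun q : (F.reconstruction e).lZ × W.DeltaYell => Sg (cmR q.1 q.2)) ≤ Sg.range := by
      rw [Subgroup.closure_le]
      rintro _ ⟨q, rfl⟩
      exact ⟨cmR q.1 q.2, rfl⟩
    refine ⟨fun _ _ => Set.mem_univ _, ?_, ?_⟩
    · intro s₁ hs₁ s₂ hs₂ h
      obtain ⟨t₁, rfl⟩ := hle hs₁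
      obtain ⟨t₂, rfl⟩ := hle hs₂
      rw [hSg_proj, hSg_proj] at h
      exact hSg_eq _ _ (hmk_eq _ _ h)
    · intro c _
      obtain ⟨g, rfl⟩ := QuotientGroup.mk_surjective c
      obtain ⟨z, hz, b, hb, k, hk, hg⟩ := (hcomm ((g : ↥R.PiY) : ↥C.Huu)).1 g.2
      have hzaug : Mt.aug (z : Mt.PiTemp) = 1 := (haugR z).1 hz
      have hbaug : Mt.aug (b : Mt.PiTemp) = 1 := (haugR b).1 hb.2
      let bY : ↥(Mt.GtpY.subgroupOf C.Huu) := ⟨b, hb.1⟩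
      have hbY : bY ∈ (F.reconstruction e).DeltaY :=
        (mem_deltaY_reconstruction_iff C μ hC hS h15 L F e bY).2 hbaug
      let a : (F.reconstruction e).lZ := (QuotientGroup.mk z : ↥C.Huu ⧸ (F.reconstruction e).inclY.range)
      let y : W.DeltaYell := QuotientGroup.mk ⟨bY, hbY⟩
      refine ⟨Sg (cmR a y), Subgroup.subset_closure ⟨(a, y), rfl⟩, ?_⟩
      rw [hSg_proj]
      apply QuotientGroup.eq.2
      rw [Subgroup.mem_subgroupOf]
      change ((cmR a y : ↥R.lDeltaTheta) : ↥C.Huu)⁻¹ * ((g : ↥R.PiY) : ↥C.Huu) ∈ R.thetaKer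
      rw [hmemK, Subgroup.coe_mul, Subgroup.coe_inv, map_mul, map_inv, inv_mul_eq_one]
      have h1 := hrepX (xrep a) z (hxrep_aug a) hzaug (hxrep_mk a) _ (hΔY (yrep y))
      have h2 := hrepY z hzaug (yrep y) ⟨bY, hbY⟩ (hyrep_mk y)
      change Mt.toTheta (((xrep a * ((yrep y : ↥(Mt.GtpY.subgroupOf C.Huu)) : ↥C.Huu) * (xrep a)⁻¹ *
          (((yrep y : ↥(Mt.GtpY.subgroupOf C.Huu)) : ↥C.Huu))⁻¹ : ↥C.Huu)) : Mt.PiTemp) = _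
      have hk1 : Mt.toTheta (k : Mt.PiTemp) = 1 := (hmemK k).1 hk
      have hg' : Mt.toTheta (((g : ↥R.PiY) : ↥C.Huu) : Mt.PiTemp) =
          Mt.toTheta (z : Mt.PiTemp) * Mt.toTheta (b : Mt.PiTemp) * (Mt.toTheta (z : Mt.PiTemp))⁻¹ *
            (Mt.toTheta (b : Mt.PiTemp))⁻¹ := by
        rw [hg]
        change Mt.toTheta ((z : Mt.PiTemp) * b * (z : Mt.PiTemp)⁻¹ * (b : Mt.PiTemp)⁻¹ * k) = _
        rw [map_mul, map_mul, map_mul, map_mul, map_inv, map_inv, hk1, mul_one]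
      rw [h1, h2, θcm, hg']
  · -- bilinearity in the `(l·ℤ)(M)`-variable
    intro a a' y
    change Sg (cmR (a * a') y) = Sg (cmR a y) * Sg (cmR a' y)
    apply hSg_mul
    have haa' : Mt.aug ((xrep a * xrep a' : ↥C.Huu) : Mt.PiTemp) = 1 := by
      rw [Subgroup.coe_mul, map_mul, hxrep_aug, hxrep_aug, mul_one]
    have hmk : (QuotientGroup.mk (xrep (a * a')) : ↥C.Huu ⧸ (F.reconstruction e).inclY.range) =
        QuotientGroup.mk (xrep a * xrep a') := by
      rw [QuotientGroup.mk_mul, hxrep_mk, hxrep_mk, hxrep_mk]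
      rfl
    rw [hrepX (xrep (a * a')) (xrep a * xrep a') (hxrep_aug _) haa' hmk _ (hΔY (yrep y)), θcm,
      θcm (xrep a) (((yrep y : ↥(F.reconstruction e).DeltaY) : ↥(Mt.GtpY.subgroupOf C.Huu)) : ↥C.Huu),
      θcm (xrep a') (((yrep y : ↥(F.reconstruction e).DeltaY) : ↥(Mt.GtpY.subgroupOf C.Huu)) : ↥C.Huu),
      Subgroup.coe_mul, map_mul]
    refine conjComm_mul_left _ _ _ ?_ ?_
    · exact (hcent _ (hcmΔΘ (xrep a') (hxrep_aug a') _ (hΔY (yrep y))) _ (hθΔ _ (hxrep_aug a))).symm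
    · exact hcommΘ _ (hcmΔΘ (xrep a) (hxrep_aug a) _ (hΔY (yrep y))) _
        (hcmΔΘ (xrep a') (hxrep_aug a') _ (hΔY (yrep y)))
  · -- bilinearity in the `Δ^ell_Y(M)`-variable
    intro a y y'
    change Sg (cmR a (y * y')) = Sg (cmR a y) * Sg (cmR a y')
    apply hSg_mul
    have hmk : (QuotientGroup.mk (yrep (y * y')) : W.DeltaYell) = QuotientGroup.mk (yrep y * yrep y') := by
      rw [QuotientGroup.mk_mul, hyrep_mk, hyrep_mk, hyrep_mk]
    rw [hrepY (xrep a) (hxrep_aug a) (yrep (y * y')) (yrep y * yrep y') hmk, θcm,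
      θcm (xrep a) (((yrep y : ↥(F.reconstruction e).DeltaY) : ↥(Mt.GtpY.subgroupOf C.Huu)) : ↥C.Huu),
      θcm (xrep a) (((yrep y' : ↥(F.reconstruction e).DeltaY) : ↥(Mt.GtpY.subgroupOf C.Huu)) : ↥C.Huu)]
    have e3 : ((((yrep y * yrep y' : ↥(F.reconstruction e).DeltaY) : ↥(Mt.GtpY.subgroupOf C.Huu)) :
        ↥C.Huu) : Mt.PiTemp) =
        (((yrep y : ↥(Mt.GtpY.subgroupOf C.Huu)) : ↥C.Huu) : Mt.PiTemp) *
          (((yrep y' : ↥(Mt.GtpY.subgroupOf C.Huu)) : ↥C.Huu) : Mt.PiTemp) := rfl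
    rw [e3, map_mul]
    refine conjComm_mul_right _ _ _ ?_
    exact (hcent _ (hcmΔΘ (xrep a) (hxrep_aug a) _ (hΔY (yrep y'))) _
      (hYΔ (hθY _ (hΔY (yrep y))))).symm

end ModelFrame

end Literature.IUT.HodgeArakelov

end
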